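import Mathlib.Analysis.InnerProductSpace.PiL2
import HarnessLib

/-!
# Route `UnitScaleTilt`, crux K1 «MinimiserStabilityRegPr» (stmt-QuantumFields-19200) — **(L6) slot `hK₂`, piece (K2b): THE DICTIONARY «OPERATOR ↔ KERNEL FORM IN AN ORTHONORMAL BASIS»**
# (so that the Matrix-currency cores ✓`Prop7IMSDoubleCommutator…`∕✓`Prop7IMSFirstOrderBlockCommutator` eat the OPERATOR-level β-row of routeR-w2's ✓`Prop7ComplementaryProjectorBlockDecayKnit`)

Cell `ym3-torus` (HUMAN RULING D-0037, rung R3 — NOT d = 4, NOT a mass gap, NOT Clay).  Width seat `ym-ust-19200-w5` (gen 13).  THEOREMS ONLY (0 `def`, 0 `sorry`), Mathlib only;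
`--supports stmt-QuantumFields-19200 --as helper`.  HONEST LABEL (№33 (6)): linear-algebra glue; nothing of (3.49), `h349`, `hGF`, EX, the crux proved.

THE POINT.  The abstract commutator cores speak of a kernel `A : Matrix n n ℂ`, vectors `v : n → ℂ`, block sums over `univ.filter (blk · = X)` and cut-offs `(h•v)_k = h_k·v_k`; the member speaks
of an operator `P` on `SiteL2K`, block-SUPPORTED fields and multiplication operators diagonal in px17's spike basis.  With an orthonormal basis `b : OrthonormalBasis n ℂ E`, the matrix
`A i k := ⟪b i, P (b k)⟫` and coordinates `v̂ k := ⟪b k, v⟫`: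
* `‖v‖² = Σ_i ‖v̂ i‖²`, `⟪b i, P w⟫ = (A *ᵥ ŵ) i`;
* for an operator `H` DIAGONAL in `b` with real entries `h` (`H (b i) = h_i • b i`): `(H w)^ = h•ŵ` and `‖P(Hw) − H(Pw)‖² = Σ_i ‖(A *ᵥ (h•ŵ)) i − h_i·(A *ᵥ ŵ) i‖²` — the LHS of the cores IS the operator commutator;
* the block kernel form IS a pairing of block-supported vectors: `Σ_{i∈S}Σ_{k∈S′} conj(û i)·A i k·ŵ k = ⟪Σ_{i∈S} û i • b i, P(Σ_{k∈S′} ŵ k • b k)⟫`, `‖Σ_{i∈S} û i • b i‖² = Σ_{i∈S} ‖û i‖²` —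
  so an operator-level row `‖⟪u, P w⟫‖ ≤ β(X,Y)‖u‖‖w‖` for `u, w` supported in blocks `X, Y` IS the cores' `hA`.

WHAT IS PROVED (ns `…Theorems.Prop7KernelFormOfOrthonormalBasis`; `E` a finite-dimensional complex inner-product space, `b : OrthonormalBasis n ℂ E`).
* §1 `normSq_eq_sum_normSq_inner`, `inner_apply_eq_mulVec`, `norm_sq_sum_smul_eq`, `inner_sum_smul_apply_sum_smul_eq`.
* §2 ★★ `coords_diag_apply` (`⟪b i, H w⟫ = h_i·⟪b i, w⟫`), ★★★ `normSq_comm_eq_sum_kernel` (the commutator dictionary), ★★★ `blockBound_matrix_of_operator` (the `hA` dictionary).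

References: T. Bałaban, CMP **99** (1985) 389–434 [Balaban1985BackgroundPropagators] ((3.21) p.394, (3.49) p.399) [folklore linear algebra].
-/

set_option autoImplicit false

noncomputable section

open scoped InnerProductSpace ComplexConjugate BigOperators Matrix
open Finset

namespace Summit.QuantumFields.YangMills.Theorems.Prop7KernelFormOfOrthonormalBasis

variable {E : Type*} [NormedAddCommGroup E] [InnerProductSpace ℂ E] {n : Type*} [Fintype n]

/-! ## §1 Coordinates -/

/-- Parseval: `‖v‖² = Σ_i ‖⟪b i, v⟫‖²`. [folklore] -/
theorem normSq_eq_sum_normSq_inner (b : OrthonormalBasis n ℂ E) (v : E) : ‖v‖ ^ 2 = ∑ i, ‖⟪b i, v⟫_ℂ‖ ^ 2 := by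
  rw [← b.repr.norm_map v, EuclideanSpace.norm_sq_eq]
  simp only [OrthonormalBasis.repr_apply_apply]

/-- Matrix of `P` in `b`: `⟪b i, P w⟫ = Σ_k ⟪b i, P (b k)⟫·⟪b k, w⟫ = (A *ᵥ ŵ) i`. [folklore] -/
theorem inner_apply_eq_mulVec (b : OrthonormalBasis n ℂ E) (P : E →ₗ[ℂ] E) (w : E) (i : n) :
    ⟪b i, P w⟫_ℂ = ((Matrix.of fun i k => ⟪b i, P (b k)⟫_ℂ) *ᵥ fun k => ⟪b k, w⟫_ℂ) i := by
  conv_lhs => rw [← b.sum_repr w]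
  simp only [map_sum, map_smul, inner_sum, inner_smul_right, OrthonormalBasis.repr_apply_apply, Matrix.mulVec, dotProduct, Matrix.of_apply]
  exact Finset.sum_congr rfl fun k _ => by ring

/-- `‖Σ_{i∈S} c_i • b i‖² = Σ_{i∈S} ‖c_i‖²`. [folklore] -/
theorem norm_sq_sum_smul_eq (b : OrthonormalBasis n ℂ E) (S : Finset n) (c : n → ℂ) :
    ‖∑ i ∈ S, c i • b i‖ ^ 2 = ∑ i ∈ S, ‖c i‖ ^ 2 := by
  have h : ⟪∑ i ∈ S, c i • b i, ∑ i ∈ S, c i • b i⟫_ℂ = ∑ i ∈ S, (starRingEnd ℂ) (c i) * c i := by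
    rw [sum_inner]
    refine Finset.sum_congr rfl fun i hi => ?_
    rw [inner_smul_left, b.orthonormal.inner_right_sum c hi]
  rw [@norm_sq_eq_re_inner ℂ, h, map_sum]
  refine Finset.sum_congr rfl fun i _ => ?_
  rw [Complex.conj_mul', ← Complex.ofReal_pow, RCLike.re_to_complex, Complex.ofReal_re]

/-- The block kernel form as a pairing: `⟪Σ_{i∈S} û_i • b i, P(Σ_{k∈S′} ŵ_k • b k)⟫ = Σ_{i∈S}Σ_{k∈S′} conj(û_i)·⟪b i, P(b k)⟫·ŵ_k`. [folklore] -/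
theorem inner_sum_smul_apply_sum_smul_eq (b : OrthonormalBasis n ℂ E) (P : E →ₗ[ℂ] E) (S S' : Finset n) (u w : n → ℂ) :
    ⟪∑ i ∈ S, u i • b i, P (∑ k ∈ S', w k • b k)⟫_ℂ = ∑ i ∈ S, ∑ k ∈ S', star (u i) * ⟪b i, P (b k)⟫_ℂ * w k := by
  rw [sum_inner]
  refine Finset.sum_congr rfl fun i _ => ?_
  rw [inner_smul_left, map_sum, inner_sum, Finset.mul_sum]
  refine Finset.sum_congr rfl fun k _ => ?_
  rw [map_smul, inner_smul_right, Complex.star_def]; ring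

/-! ## §2 The two dictionaries -/

/-- ★★ Coordinates of a `b`-DIAGONAL operator: `H (b i) = h_i • b i` with REAL `h` ⟹ `⟪b i, H w⟫ = h_i·⟪b i, w⟫`. [folklore] -/
theorem coords_diag_apply (b : OrthonormalBasis n ℂ E) (H : E →ₗ[ℂ] E) (h : n → ℝ) (hH : ∀ i, H (b i) = ((h i : ℝ) : ℂ) • b i)
    (hHsym : ∀ x y : E, ⟪H x, y⟫_ℂ = ⟪x, H y⟫_ℂ) (w : E) (i : n) :
    ⟪b i, H w⟫_ℂ = ((h i : ℝ) : ℂ) * ⟪b i, w⟫_ℂ := by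
  rw [← hHsym, hH, inner_smul_left, Complex.conj_ofReal]

/-- ★★★ **THE COMMUTATOR DICTIONARY**: for `H` diagonal in `b` (real entries `h`, symmetric) and any `P`,
`‖P(Hw) − H(Pw)‖² = Σ_i ‖(A *ᵥ (h•ŵ)) i − h_i·(A *ᵥ ŵ) i‖²` with `A i k = ⟪b i, P(b k)⟫`, `ŵ k = ⟪b k, w⟫` — the left-hand side of ✓`Prop7IMSFirstOrderBlockCommutator`'s rows IS the
operator commutator. [folklore] -/
theorem normSq_comm_eq_sum_kernel (b : OrthonormalBasis n ℂ E) (P H : E →ₗ[ℂ] E) (h : n → ℝ) (hH : ∀ i, H (b i) = ((h i : ℝ) : ℂ) • b i)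
    (hHsym : ∀ x y : E, ⟪H x, y⟫_ℂ = ⟪x, H y⟫_ℂ) (w : E) :
    ‖P (H w) - H (P w)‖ ^ 2
      = ∑ i, ‖((Matrix.of fun i k => ⟪b i, P (b k)⟫_ℂ) *ᵥ fun k => ((h k : ℝ) : ℂ) * ⟪b k, w⟫_ℂ) i
          - ((h i : ℝ) : ℂ) * ((Matrix.of fun i k => ⟪b i, P (b k)⟫_ℂ) *ᵥ fun k => ⟪b k, w⟫_ℂ) i‖ ^ 2 := by
  rw [normSq_eq_sum_normSq_inner b]
  have hfg : (fun k => ⟪b k, H w⟫_ℂ) = fun k => ((h k : ℝ) : ℂ) * ⟪b k, w⟫_ℂ := funext fun k => coords_diag_apply b H h hH hHsym w k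
  refine Finset.sum_congr rfl fun i _ => ?_
  rw [inner_sub_right, inner_apply_eq_mulVec b P (H w) i, coords_diag_apply b H h hH hHsym (P w) i, inner_apply_eq_mulVec b P w i, hfg]

/-- ★★★ **THE `hA` DICTIONARY**: an operator-level block row `‖⟪u, P w⟫‖ ≤ β·‖u‖·‖w‖` for ALL `u` in the span of `{b i : i ∈ S}` and `w` in the span of `{b k : k ∈ S′}` gives the cores' kernel row
`‖Σ_{i∈S}Σ_{k∈S′} conj(û_i)·A i k·ŵ_k‖ ≤ β·√(Σ_{i∈S}‖û_i‖²)·√(Σ_{k∈S′}‖ŵ_k‖²)` for all coordinate vectors. [folklore] -/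
theorem blockBound_matrix_of_operator (b : OrthonormalBasis n ℂ E) (P : E →ₗ[ℂ] E) (S S' : Finset n) {βv : ℝ}
    (hP : ∀ (cu cw : n → ℂ), ‖⟪∑ i ∈ S, cu i • b i, P (∑ k ∈ S', cw k • b k)⟫_ℂ‖ ≤ βv * ‖∑ i ∈ S, cu i • b i‖ * ‖∑ k ∈ S', cw k • b k‖)
    (u w : n → ℂ) :
    ‖∑ i ∈ S, ∑ k ∈ S', star (u i) * ⟪b i, P (b k)⟫_ℂ * w k‖ ≤ βv * Real.sqrt (∑ i ∈ S, ‖u i‖ ^ 2) * Real.sqrt (∑ k ∈ S', ‖w k‖ ^ 2) := by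
  rw [← inner_sum_smul_apply_sum_smul_eq b P S S' u w, ← norm_sq_sum_smul_eq b S u, ← norm_sq_sum_smul_eq b S' w,
    Real.sqrt_sq (norm_nonneg _), Real.sqrt_sq (norm_nonneg _)]
  exact hP u w

end Summit.QuantumFields.YangMills.Theorems.Prop7KernelFormOfOrthonormalBasis

end
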